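/-
Copyright (c) 2026 the pub-hodgecm-mathlib formalisation cell (harness21).  Prover seat hodgecm-mathlib-F0P3a-p06 (g26), 2026-09-03.  E1 BRICK LEDGER row 56-B3(48) «TAME TWINS OF ★
48-DATUM» (E1 keeper ∕ dealer F0P3a-p03 (g30) deal 03:59:19Z; LEAD F0P3a-plan T15-42 (iii)); census `F0/P3a/F0P3a-p06/g26/b348/CENSUS-B3-48.v1.F0P3ap06g26.md`.  FILE 1 of 2.
-/
import Summits.HodgeConjecture.HodgeConjecture.Theorems.F0P3cStCharTSEPFunctionOrbitalOrbits       -- ★ 48-datum FILE 1 p853433 (F0P3a-p01 g23): the FIVE PLACE-FREE heads are used BY NAME (§1 lemmas, `isCompact_setOf_actionHom_apply_eq`, `mapEdgeSet_eq_iff`, `classOrbitalIntegral_kType_vertex_eq`); brings ★ 41g-H's letters and ★ R48-gen FILE 2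
import Literature.NumberTheory.Automorphic.UnitaryLatticeTreeEulerRelationRamified                  -- ★ E4-RAM `forall_flag_exists_unitary_of_v_two` (one edge orbit, `|2| = 1`, any involution)
import Literature.NumberTheory.Automorphic.UnitaryLatticeTreeTypeTwoTransitiveRamified              -- ★ `forall_isVertexLattice_two_exists_mapGL_N₁_eq_of_neg` (one type-two orbit at a tame ramified place)
import Literature.NumberTheory.Automorphic.UnitaryLatticeTreeSelfDualTransitiveTame                 -- ★ `exists_unitary_mapGL_stdLattice_eq_of_isSelfDualLattice_of_v_two` (one self-dual orbit, `|2| = 1`)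
import Literature.NumberTheory.Automorphic.UnitaryLatticeTreeLevelGroupsPackage                     -- ★ FILE P (+ §6 PLACE-FREE (U4) `latticeGraphIso_apply_eq_of_mem_unitaryLevel_of_adj_of_v`, E1 row B2 «41g-RAM», LH6-p04 g11)
import HarnessLib

/-!
# Row 56-B3(48), FILE 1 of 2 — THE TAME TWIN of ★ 48-datum FILE 1 «THE THREE FACET ORBITS»: the orbital integral of ONE `K`-type function on `G_v = U(Φ₃)(L⁺_v)` at a regular
# elliptic class, unfolded over one facet orbit of the Bruhat–Tits tree, WITHOUT the unramified datum ([SchneiderStuhler1997 §III.4], [Kottwitz1988 §2], [Rogawski1990 §4.9, §12.5])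

Cell `pub/hodgecm-mathlib` (D-0151), crux H413 = `stmt-HodgeConjecture-24833`; lane `--kind proof --supports stmt-HodgeConjecture-24833 --as helper` (THEOREMS ONLY: no definition ∕
instance ∕ notation ∕ named fact ∕ `sorry`; count-neutral: closes no node).  Namespace `Summit.HodgeConjecture.HodgeConjecture.Cruxes.H413.F0P3cStCharTSEPFunctionOrbitalOrbitsRamified`.
Sibling of ★ `…F0P3cStCharTSEPFunctionOrbitalOrbits` (row 48 FILE 1, p853433) on ★ B3(53)'s pattern (p853453): the SAME four `hd`-reading heads with the suffix `_of_involution` (place ∕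
orbit letters hypothesis-style: `hvσ hϖ`, the vertex-orbit transitivities `htr₀ htr₂` in ★ B3(53)'s spelling, the flag transitivity `hflag` in ★ E4's output shape, the edge transitivity
`htrE`) and `_of_v_two` ∕ `_of_neg` (TAME dischargers over the seven letters `hσ hvσ hϖ hσϖ hres h2 hnorm` of ★ `isTree_latticeGraph_three_of_neg`: ★ `exists_unitary_mapGL_stdLattice_eq_of_
isSelfDualLattice_of_v_two`, ★ `forall_isVertexLattice_two_exists_mapGL_N₁_eq_of_neg`, ★ E4-RAM `forall_flag_exists_unitary_of_v_two`, ★ FILE P §6 (U4)-PF); conclusions VERBATIM, the place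
letters sitting exactly where `hd` sat (after `{ϖ}`, before `eA`).  The five heads of ★ 48 FILE 1 that never read `hd` (`mem_normalizer_sup_of_mem`, `epSum_arith`,
`isCompact_setOf_actionHom_apply_eq`, `mapEdgeSet_eq_iff`, `classOrbitalIntegral_kType_vertex_eq`) are used BY NAME, not re-issued.  FILE 2 (`…OrbitalEllipticRamified`) is the HEAD.
HONEST LABEL: count-neutral datum helper; TAME road GO-LOW (LEAD T15-42); WILD (dyadic) places stay PRINT (`h2 : |2| = 1` is a binder); (R-SS) NOT chartered; E1 = PRINT until the
keeper's charter test; h413 OPEN; HC_CM is proved only modulo the 7 printed citations (2 remaining named inputs hLiu418 = stmt-HodgeConjecture-24832, h413 = stmt-HodgeConjecture-24833)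
until rung 0 closes; nothing printed is asserted here.

LETTERS = ★ 48's: `(w hw ϖ eA)` the (G3)-EXPLICIT one-place model, `{a} ha` the action hom `G_v →* Aut(tree)`, `(τ) hτ` an invariant orientation (`tail < head`), `{e U} hU` the unitary
level family at level `ϖ^(e+1)` with `hEo hEc`, `(νQv) (hcanQ)` the measure letters, `hreg`∕`hell` (regular elliptic `γ`), a base edge `d₁` with stabiliser `P₁` (`hP₁`), `τ₁ = ρ|_{P₁}`
on `V^{U_{d₁}}` trivial on `U_{d₁}`, `f = 𝟙_{P₁} · χ_{τ₁}(·⁻¹)` (★ row 42's `hfP`∕`hf0`).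

* §1 (`_of_involution`) `exists_actionHom_apply_eq_of_isVertexLattice_zero_of_involution` (`htr₀`), `…_two_of_involution` (`htr₂`), `exists_mapEdgeSet_eq_of_involution` (`hvσ hϖ hflag`),
  **`classOrbitalIntegral_kType_edge_eq_of_involution`** (`hvσ hϖ htrE`): `Φ^{can}(γ, 𝟙_{P₁} χ_{τ₁}(·⁻¹)) = ν(P₁) · Σᶠ_{d ∈ X^γ¹} Θ_{U_d}(γ⁻¹)`.
* §2 (TAME dischargers) `…_zero_of_v_two` (`hσ hvσ hϖ h2`), `…_two_of_neg` (`hσ hvσ hϖ hσϖ hres h2 hnorm`), `exists_mapEdgeSet_eq_of_v_two` (`hσ hvσ hϖ h2`),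
  **`classOrbitalIntegral_kType_edge_eq_of_v_two`** (`hσ hvσ hϖ h2`) — the edge orbit needs only `|2| = 1` and an involution, not `σϖ = −ϖ`.

## References
* [SchneiderStuhler1997] P. Schneider, U. Stuhler, *Representation theory and sheaves on the Bruhat–Tits building*, Publ. Math. IHÉS 85 (1997): §III.4.
* [Kottwitz1988] R. E. Kottwitz, *Tamagawa numbers*, Ann. of Math. 127 (1988): §2.
* [Rogawski1990] J. D. Rogawski, *Automorphic Representations of Unitary Groups in Three Variables* (1990): §4.9 p. 54, §12.5 pp. 182–187.
* [BruhatTits1972] F. Bruhat, J. Tits, *Groupes réductifs sur un corps local* I, Publ. Math. IHÉS 41 (1972): §10.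
* [Jacobowitz1962] R. Jacobowitz, *Hermitian forms over local fields*, Amer. J. Math. 84 (1962): §4–§8.
-/

set_option autoImplicit false

set_option linter.dupNamespace false

noncomputable section

open NumberField IsDedekindDomain MeasureTheory Measure
open scoped Pointwise Valued WithZero Matrix MatrixGroups
open Literature.NumberTheory.Rogawski1990 Literature.NumberTheory.Rogawski1990.Ch12Sec5
open Literature.NumberTheory.Automorphic Literature.NumberTheory.Automorphic.UnitaryGroup Literature.NumberTheory.Automorphic.UnitaryLatticeTree
open Literature.NumberTheory.Automorphic.HermitianLattice Literature.NumberTheory.GaloisRepresentations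
open Literature.Combinatorics.SimpleGraph Literature.Combinatorics.SimpleGraph.OrientedIncidence

namespace Summit.HodgeConjecture.HodgeConjecture.Cruxes.H413.F0P3cStCharTSEPFunctionOrbitalOrbitsRamified

open Summit.HodgeConjecture.HodgeConjecture.Cruxes.H413
open Summit.HodgeConjecture.HodgeConjecture.Cruxes.H413.F0P3cStCharTSCharacterEllipticUniform
open Summit.HodgeConjecture.HodgeConjecture.Cruxes.H413.F0P3cStCharTSEPFunctionOrbitalOrbits

section Datum

variable (L : Type) [Field L] [NumberField L] [IsCMField L] (v : HeightOneSpectrum (𝓞 ↥(maximalRealSubfield L)))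
  (w : PlacesOver L v) (hw : IsCMField.complexConj L • w.1 = w.1) {ϖ : (w.1.adicCompletion L)}

/-! ## §1 Place ∕ orbit letters hypothesis-style (`_of_involution`) -/

/-- **ONE ORBIT OF SELF-DUAL VERTICES, transitivity hypothesis-style** (`htr₀`: every self-dual vertex lattice is `u·L₀`, ★ B3(53)'s letter): `G_v` is transitive on the
self-dual vertices — ★ 48's `exists_actionHom_apply_eq_of_isVertexLattice_zero` with `hd` replaced by `htr₀`, conclusion VERBATIM. [cite: BruhatTits1972, §10]
[cite: SchneiderStuhler1997, §III.4] -/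
theorem exists_actionHom_apply_eq_of_isVertexLattice_zero_of_involution
    (eA : (Gqs L v) ≃ₜ* ↥(unitaryGroupOfForm (galAdicCompletionMap (L := L) (IsCMField.complexConj L) hw) ((StdForm.antidiagonal 3).over (w.1.adicCompletion L))))
    {a : (Gqs L v) →* ((latticeGraph (galAdicCompletionMap (L := L) (IsCMField.complexConj L) hw) ϖ ((StdForm.antidiagonal 3).over (w.1.adicCompletion L))) ≃g (latticeGraph (galAdicCompletionMap (L := L) (IsCMField.complexConj L) hw) ϖ ((StdForm.antidiagonal 3).over (w.1.adicCompletion L))))} (ha : ∀ g, a g = latticeGraphIso (galAdicCompletionMap (L := L) (IsCMField.complexConj L) hw) ϖ ((StdForm.antidiagonal 3).over (w.1.adicCompletion L)) (eA g))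
    (htr₀ : ∀ M : Submodule 𝒪[(w.1.adicCompletion L)] (Fin 3 → (w.1.adicCompletion L)), IsSelfDualLattice (galAdicCompletionMap (L := L) (IsCMField.complexConj L) hw) ϖ ((StdForm.antidiagonal 3).over (w.1.adicCompletion L)) M → ∃ u : ↥(unitaryGroupOfForm (galAdicCompletionMap (L := L) (IsCMField.complexConj L) hw) ((StdForm.antidiagonal 3).over (w.1.adicCompletion L))), M = mapGL (u : GL (Fin 3) (w.1.adicCompletion L)) (stdLattice (w.1.adicCompletion L) 3))
    (x y : {M : Submodule 𝒪[(w.1.adicCompletion L)] (Fin 3 → (w.1.adicCompletion L)) // IsVertex (galAdicCompletionMap (L := L) (IsCMField.complexConj L) hw) ϖ ((StdForm.antidiagonal 3).over (w.1.adicCompletion L)) M}) (hx : IsVertexLattice (galAdicCompletionMap (L := L) (IsCMField.complexConj L) hw) ϖ ((StdForm.antidiagonal 3).over (w.1.adicCompletion L)) 0 x.1) (hy : IsVertexLattice (galAdicCompletionMap (L := L) (IsCMField.complexConj L) hw) ϖ ((StdForm.antidiagonal 3).over (w.1.adicCompletion L)) 0 y.1) : ∃ g : (Gqs L v), a g x =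 y := by
  obtain ⟨u, hu⟩ := htr₀ y.1 hy
  obtain ⟨u₀, hu₀⟩ := htr₀ x.1 hx
  refine ⟨eA.symm (u * u₀⁻¹), Subtype.ext ?_⟩
  rw [ha, ContinuousMulEquiv.apply_symm_apply, latticeGraphIso_apply_val, hu₀, Subgroup.coe_mul, Subgroup.coe_inv, ← mapGL_mul,
    inv_mul_cancel_right, ← hu]

/-- **ONE ORBIT OF TYPE-TWO VERTICES, transitivity hypothesis-style** (`htr₂`: every type-two vertex lattice is `u·N₁`, ★ B3(53)'s letter) — ★ 48's
`exists_actionHom_apply_eq_of_isVertexLattice_two` with `hd` replaced by `htr₂`, conclusion VERBATIM. [cite: BruhatTits1972, §10] [cite: SchneiderStuhler1997, §III.4] -/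
theorem exists_actionHom_apply_eq_of_isVertexLattice_two_of_involution
    (eA : (Gqs L v) ≃ₜ* ↥(unitaryGroupOfForm (galAdicCompletionMap (L := L) (IsCMField.complexConj L) hw) ((StdForm.antidiagonal 3).over (w.1.adicCompletion L))))
    {a : (Gqs L v) →* ((latticeGraph (galAdicCompletionMap (L := L) (IsCMField.complexConj L) hw) ϖ ((StdForm.antidiagonal 3).over (w.1.adicCompletion L))) ≃g (latticeGraph (galAdicCompletionMap (L := L) (IsCMField.complexConj L) hw) ϖ ((StdForm.antidiagonal 3).over (w.1.adicCompletion L))))} (ha : ∀ g, a g = latticeGraphIso (galAdicCompletionMap (L := L) (IsCMField.complexConj L) hw) ϖ ((StdForm.antidiagonal 3).over (w.1.adicCompletion L)) (eA g))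
    (htr₂ : ∀ M : Submodule 𝒪[(w.1.adicCompletion L)] (Fin 3 → (w.1.adicCompletion L)), IsVertexLattice (galAdicCompletionMap (L := L) (IsCMField.complexConj L) hw) ϖ ((StdForm.antidiagonal 3).over (w.1.adicCompletion L)) 2 M → ∃ u : ↥(unitaryGroupOfForm (galAdicCompletionMap (L := L) (IsCMField.complexConj L) hw) ((StdForm.antidiagonal 3).over (w.1.adicCompletion L))), M = mapGL (u : GL (Fin 3) (w.1.adicCompletion L)) (latt (Matrix.diagonal ![(1 : (w.1.adicCompletion L)), 1, ϖ])))
    (x y : {M : Submodule 𝒪[(w.1.adicCompletion L)] (Fin 3 → (w.1.adicCompletion L)) // IsVertex (galAdicCompletionMap (L := L) (IsCMField.complexConj L) hw) ϖ ((StdForm.antidiagonal 3).over (w.1.adicCompletion L)) M}) (hx : IsVertexLattice (galAdicCompletionMap (L := L) (IsCMField.complexConj L) hw) ϖ ((StdForm.antidiagonal 3).over (w.1.adicCompletion L)) 2 x.1) (hy : IsVertexLattice (galAdicCompletionMap (L := L) (IsCMField.complexConj L) hw) ϖ ((StdForm.antidiagonal 3).over (w.1.adicCompletion L)) 2 y.1)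 : ∃ g : (Gqs L v), a g x = y := by
  obtain ⟨u, hu⟩ := htr₂ y.1 hy
  obtain ⟨u₀, hu₀⟩ := htr₂ x.1 hx
  refine ⟨eA.symm (u * u₀⁻¹), Subtype.ext ?_⟩
  rw [ha, ContinuousMulEquiv.apply_symm_apply, latticeGraphIso_apply_val, hu₀, Subgroup.coe_mul, Subgroup.coe_inv, ← mapGL_mul,
    inv_mul_cancel_right, ← hu]

set_option maxHeartbeats 800000 in
/-- **ONE ORBIT OF EDGES, flag transitivity hypothesis-style** (`hflag` in ★ E4's output shape: flags `M₂ < M₀`, `M₀` self-dual, `M₂` of type two, are moved by `U(σ_w, J₀)`; place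
letters `|σ_w ·| = |·|`, `|ϖ| = q⁻¹` for the types of the ends, ★ `type_of_lt_three`) — ★ 48's `exists_mapEdgeSet_eq` with `hd` replaced by `hvσ hϖ hflag`, conclusion VERBATIM.
[cite: BruhatTits1972, §10] [cite: SchneiderStuhler1997, §III.4] -/
theorem exists_mapEdgeSet_eq_of_involution
    (hvσ : ∀ x, Valued.v ((galAdicCompletionMap (L := L) (IsCMField.complexConj L) hw) x) = Valued.v x) (hϖ : Valued.v ϖ = WithZero.exp (-1 : ℤ))
    (hflag : ∀ g₁ : GL (Fin 3) (w.1.adicCompletion L), (g₁ : Matrix (Fin 3) (Fin 3) (w.1.adicCompletion L)) = Matrix.diagonal ![(1 : (w.1.adicCompletion L)), 1, ϖ] →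
      ∀ M₀ M₂ : Submodule 𝒪[(w.1.adicCompletion L)] (Fin 3 → (w.1.adicCompletion L)), IsSelfDualLattice (galAdicCompletionMap (L := L) (IsCMField.complexConj L) hw) ϖ ((StdForm.antidiagonal 3).over (w.1.adicCompletion L)) M₀ → IsVertexLattice (galAdicCompletionMap (L := L) (IsCMField.complexConj L) hw) ϖ ((StdForm.antidiagonal 3).over (w.1.adicCompletion L)) 2 M₂ → M₂ < M₀ →
        ∃ u : ↥(unitaryGroupOfForm (galAdicCompletionMap (L := L) (IsCMField.complexConj L) hw) ((StdForm.antidiagonal 3).over (w.1.adicCompletion L))), mapGL (u : GL (Fin 3) (w.1.adicCompletion L)) (stdLattice (w.1.adicCompletion L) 3) = M₀ ∧ mapGL ((u : GL (Fin 3) (w.1.adicCompletion L)) * g₁) (stdLattice (w.1.adicCompletion L) 3) = M₂)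
    (eA : (Gqs L v) ≃ₜ* ↥(unitaryGroupOfForm (galAdicCompletionMap (L := L) (IsCMField.complexConj L) hw) ((StdForm.antidiagonal 3).over (w.1.adicCompletion L))))
    {a : (Gqs L v) →* ((latticeGraph (galAdicCompletionMap (L := L) (IsCMField.complexConj L) hw) ϖ ((StdForm.antidiagonal 3).over (w.1.adicCompletion L))) ≃g (latticeGraph (galAdicCompletionMap (L := L) (IsCMField.complexConj L) hw) ϖ ((StdForm.antidiagonal 3).over (w.1.adicCompletion L))))} (ha : ∀ g, a g = latticeGraphIso (galAdicCompletionMap (L := L) (IsCMField.complexConj L) hw) ϖ ((StdForm.antidiagonal 3).over (w.1.adicCompletion L)) (eA g))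
    (τ : Orientation (latticeGraph (galAdicCompletionMap (L := L) (IsCMField.complexConj L) hw) ϖ ((StdForm.antidiagonal 3).over (w.1.adicCompletion L)))) (hτ : ∀ d, τ.tail d < τ.head d)
    (d d' : (latticeGraph (galAdicCompletionMap (L := L) (IsCMField.complexConj L) hw) ϖ ((StdForm.antidiagonal 3).over (w.1.adicCompletion L))).edgeSet) : ∃ g : (Gqs L v), (a g).mapEdgeSet d = d' := by
  have hJ : Valued.v (((StdForm.antidiagonal 3).over (w.1.adicCompletion L))).det = 1 := v_det_antidiagonal_three
  have hϖ0 : ϖ ≠ 0 := CartanUnique.uniformizer_ne_zero hϖ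
  obtain ⟨g₁, hg₁⟩ : ∃ g₁ : GL (Fin 3) (w.1.adicCompletion L), (g₁ : Matrix (Fin 3) (Fin 3) (w.1.adicCompletion L)) = Matrix.diagonal ![(1 : (w.1.adicCompletion L)), 1, ϖ] := by
    refine ⟨glDiagonal 3 (w.1.adicCompletion L) ![1, 1, Units.mk0 ϖ hϖ0], ?_⟩
    rw [coe_glDiagonal]
    congr 1
    funext i
    fin_cases i <;> rfl
  have hmapE : ∀ (g : (Gqs L v)) (c : (latticeGraph (galAdicCompletionMap (L := L) (IsCMField.complexConj L) hw) ϖ ((StdForm.antidiagonal 3).over (w.1.adicCompletion L))).edgeSet), (((a g).mapEdgeSet c : (latticeGraph (galAdicCompletionMap (L := L) (IsCMField.complexConj L) hw) ϖ ((StdForm.antidiagonal 3).over (w.1.adicCompletion L))).edgeSet) : Sym2 {M : Submodule 𝒪[(w.1.adicCompletion L)] (Fin 3 → (w.1.adicCompletion L)) // IsVertex (galAdicCompletionMap (L := L) (IsCMField.complexConj L) hw) ϖ ((StdForm.antidiagonal 3).over (w.1.adicCompletion L)) M}) = s(a g (τ.head c), a g (τ.tail c)) := fun g c =>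
    BakerNorine.coe_mapEdgeSet τ (a g) c
  obtain ⟨k₀, hk₀⟩ := (τ.head d).2
  obtain ⟨k₂, hk₂⟩ := (τ.tail d).2
  obtain ⟨hk₂2, hk₀0⟩ := type_of_lt_three hvσ hϖ hJ hk₂ hk₀ (Subtype.coe_lt_coe.2 (hτ d))
  subst hk₂2 hk₀0
  obtain ⟨j₀, hj₀⟩ := (τ.head d').2
  obtain ⟨j₂, hj₂⟩ := (τ.tail d').2
  obtain ⟨hj₂2, hj₀0⟩ := type_of_lt_three hvσ hϖ hJ hj₂ hj₀ (Subtype.coe_lt_coe.2 (hτ d'))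
  subst hj₂2 hj₀0
  obtain ⟨u, hu, hu'⟩ := hflag g₁ hg₁ (τ.head d').1 (τ.tail d').1 hj₀ hj₂ (Subtype.coe_lt_coe.2 (hτ d'))
  obtain ⟨u₁, hu₁, hu₁'⟩ := hflag g₁ hg₁ (τ.head d).1 (τ.tail d).1 hk₀ hk₂ (Subtype.coe_lt_coe.2 (hτ d))
  have hh : a (eA.symm (u * u₁⁻¹)) (τ.head d) = τ.head d' := Subtype.ext (by
    rw [ha, ContinuousMulEquiv.apply_symm_apply, latticeGraphIso_apply_val, ← hu₁, Subgroup.coe_mul, Subgroup.coe_inv, ← mapGL_mul,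
      inv_mul_cancel_right, hu])
  have ht : a (eA.symm (u * u₁⁻¹)) (τ.tail d) = τ.tail d' := Subtype.ext (by
    rw [ha, ContinuousMulEquiv.apply_symm_apply, latticeGraphIso_apply_val, ← hu₁', Subgroup.coe_mul, Subgroup.coe_inv, ← mapGL_mul,
      ← mul_assoc, inv_mul_cancel_right, hu'])
  exact ⟨eA.symm (u * u₁⁻¹), Subtype.ext (by rw [hmapE, hh, ht, τ.mk_head_tail])⟩

set_option maxHeartbeats 1600000 in
/-- **THE ORBITAL INTEGRAL OF A `K`-TYPE FUNCTION ON THE EDGE ORBIT, place letters hypothesis-style**: for the base edge `d₁` with stabiliser `P₁` (`hP₁`), `τ₁ = ρ|_{P₁}` on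
`V^{U_{d₁}}` trivial on `U_{d₁}`, `f = 𝟙_{P₁} · χ_{τ₁}(·⁻¹)`, a regular elliptic `γ`, the edge transitivity `htrE` hypothesis-style and the place letters `|σ_w ·| = |·|`, `|ϖ| = q⁻¹`
(for «level `≥ 1` fixes the closed star», ★ FILE P §6 `latticeGraphIso_apply_eq_of_mem_unitaryLevel_of_adj_of_v`): `Φ^{can}(γ, f) = ν(P₁) · Σᶠ_{d ∈ X^γ¹} Θ_{U_d}(γ⁻¹)` — ★ 48's
`classOrbitalIntegral_kType_edge_eq` with `hd` replaced by `hvσ hϖ` + `htrE`, conclusion VERBATIM. [cite: SchneiderStuhler1997, §III.4] [cite: Kottwitz1988, §2] [cite: Rogawski1990, §4.9 p. 54] -/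
theorem classOrbitalIntegral_kType_edge_eq_of_involution
    (hvσ : ∀ x, Valued.v ((galAdicCompletionMap (L := L) (IsCMField.complexConj L) hw) x) = Valued.v x) (hϖ : Valued.v ϖ = WithZero.exp (-1 : ℤ))
    (eA : (Gqs L v) ≃ₜ* ↥(unitaryGroupOfForm (galAdicCompletionMap (L := L) (IsCMField.complexConj L) hw) ((StdForm.antidiagonal 3).over (w.1.adicCompletion L))))
    {a : (Gqs L v) →* ((latticeGraph (galAdicCompletionMap (L := L) (IsCMField.complexConj L) hw) ϖ ((StdForm.antidiagonal 3).over (w.1.adicCompletion L))) ≃g (latticeGraph (galAdicCompletionMap (L := L) (IsCMField.complexConj L) hw) ϖ ((StdForm.antidiagonal 3).over (w.1.adicCompletion L))))} (ha : ∀ g, a g = latticeGraphIso (galAdicCompletionMap (L := L) (IsCMField.complexConj L) hw) ϖ ((StdForm.antidiagonal 3).over (w.1.adicCompletion L)) (eA g))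
    [MeasurableSpace (Gqs L v)] [BorelSpace (Gqs L v)]
    [∀ γ : (Gqs L v), MeasurableSpace ((Gqs L v) ⧸ Subgroup.centralizer ({γ} : Set (Gqs L v)))]
    [∀ γ : (Gqs L v), BorelSpace ((Gqs L v) ⧸ Subgroup.centralizer ({γ} : Set (Gqs L v)))]
    (νQv : Measure (Gqs L v)) [νQv.IsHaarMeasure] [νQv.IsMulRightInvariant]
    {mQv : OrbitalMeasureFamily (Gqs L v)} (hcanQ : mQv.IsCanonical (fun γ => IsRegularElt (γ.val : GL (Fin 3) (UnitaryGroup.LocalRing L v))) νQv)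
    (τ : Orientation (latticeGraph (galAdicCompletionMap (L := L) (IsCMField.complexConj L) hw) ϖ ((StdForm.antidiagonal 3).over (w.1.adicCompletion L)))) (hτ : ∀ d, τ.tail d < τ.head d)
    (htrE : ∀ d d' : (latticeGraph (galAdicCompletionMap (L := L) (IsCMField.complexConj L) hw) ϖ ((StdForm.antidiagonal 3).over (w.1.adicCompletion L))).edgeSet, ∃ g : (Gqs L v), (a g).mapEdgeSet d = d')
    {e : ℕ} {U : {M : Submodule 𝒪[(w.1.adicCompletion L)] (Fin 3 → (w.1.adicCompletion L)) // IsVertex (galAdicCompletionMap (L := L) (IsCMField.complexConj L) hw) ϖ ((StdForm.antidiagonal 3).over (w.1.adicCompletion L)) M} → Subgroup (Gqs L v)}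
    (hU : ∀ x g, g ∈ U x ↔ mapGL ((eA g : ↥(unitaryGroupOfForm (galAdicCompletionMap (L := L) (IsCMField.complexConj L) hw) ((StdForm.antidiagonal 3).over (w.1.adicCompletion L)))) : GL (Fin 3) (w.1.adicCompletion L)) x.1 = x.1 ∧
      x.1.map ((Matrix.toLin' ((((eA g : ↥(unitaryGroupOfForm (galAdicCompletionMap (L := L) (IsCMField.complexConj L) hw) ((StdForm.antidiagonal 3).over (w.1.adicCompletion L)))) : GL (Fin 3) (w.1.adicCompletion L)) : Matrix (Fin 3) (Fin 3) (w.1.adicCompletion L)) - 1)).restrictScalars 𝒪[(w.1.adicCompletion L)]) ≤ scaleLattice (ϖ ^ (e + 1)) x.1)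
    (hEo : ∀ d : (latticeGraph (galAdicCompletionMap (L := L) (IsCMField.complexConj L) hw) ϖ ((StdForm.antidiagonal 3).over (w.1.adicCompletion L))).edgeSet, IsOpen ((U (τ.head d) ⊔ U (τ.tail d) : Subgroup (Gqs L v)) : Set (Gqs L v)))
    (hEc : ∀ d : (latticeGraph (galAdicCompletionMap (L := L) (IsCMField.complexConj L) hw) ϖ ((StdForm.antidiagonal 3).over (w.1.adicCompletion L))).edgeSet, IsCompact ((U (τ.head d) ⊔ U (τ.tail d) : Subgroup (Gqs L v)) : Set (Gqs L v)))
    (d₁ : (latticeGraph (galAdicCompletionMap (L := L) (IsCMField.complexConj L) hw) ϖ ((StdForm.antidiagonal 3).over (w.1.adicCompletion L))).edgeSet) (P₁ : Subgroup (Gqs L v)) (hP₁ : ∀ g, g ∈ P₁ ↔ (a g).mapEdgeSet d₁ = d₁)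
    {V : Type*} [AddCommGroup V] [Module ℂ V] (ρ : Representation ℂ (Gqs L v) V) [FiniteDimensional ℂ ↥(ρ.fixedPoints (U (τ.head d₁) ⊔ U (τ.tail d₁)))]
    (τ₁ : Representation ℂ ↥P₁ ↥(ρ.fixedPoints (U (τ.head d₁) ⊔ U (τ.tail d₁))))
    (hτρ₁ : ∀ (p : ↥P₁) (x : ↥(ρ.fixedPoints (U (τ.head d₁) ⊔ U (τ.tail d₁)))), ((τ₁ p x : ↥(ρ.fixedPoints (U (τ.head d₁) ⊔ U (τ.tail d₁)))) : V) = ρ (p : (Gqs L v)) (x : V))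
    (hτ₁ : ∀ p : ↥P₁, (p : (Gqs L v)) ∈ U (τ.head d₁) ⊔ U (τ.tail d₁) → τ₁ p = 1)
    {f : (Gqs L v) → ℂ} (hfP : ∀ (g : (Gqs L v)) (hg : g ∈ P₁), f g = Representation.character τ₁ ⟨g, hg⟩⁻¹) (hf0 : ∀ g ∉ P₁, f g = 0)
    {γ : (Gqs L v)} (hreg : IsRegularElt (γ.val : GL (Fin 3) (UnitaryGroup.LocalRing L v)))
    (hell : IsCompact ((Subgroup.centralizer ({γ} : Set (Gqs L v))) : Set (Gqs L v))) :
    classOrbitalIntegral mQv f (ConjClasses.mk γ) =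
      νQv.real (P₁ : Set (Gqs L v)) • ∑ᶠ d ∈ {d : (latticeGraph (galAdicCompletionMap (L := L) (IsCMField.complexConj L) hw) ϖ ((StdForm.antidiagonal 3).over (w.1.adicCompletion L))).edgeSet | (a γ).mapEdgeSet d = d}, ρ.levelTrace (hEo d) (hEc d) γ⁻¹ := by
  have hHf : ((qsForm L).map (cmConjRingHom L))ᵀ = qsForm L := UnitaryGroup.antidiagOne_isHermitian L 3
  have hdetf : (qsForm L).det ≠ 0 := (UnitaryGroup.isUnit_antidiagOne_det L 3).ne_zero
  have hQ : ∀ g x : (Gqs L v), IsRegularElt (g.val : GL (Fin 3) (UnitaryGroup.LocalRing L v)) →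
      IsRegularElt ((x * g * x⁻¹ : (Gqs L v)).val : GL (Fin 3) (UnitaryGroup.LocalRing L v)) := fun g x hg => UnitaryGroup.isRegularElt_val_conj L 3 (qsForm L) v g x hg
  haveI : CompactSpace (Subgroup.centralizer ({γ} : Set (Gqs L v))) := isCompact_iff_compactSpace.1 hell
  have hO : IsClosed {x : (Gqs L v) | ∃ y : (Gqs L v), y * γ * y⁻¹ = x} := UnitaryGroup.isClosed_conjClass_local_of_isRegularElt L 3 (qsForm L) v hHf hdetf γ hreg
  -- orientation transport and «a fixed edge has fixed ends»
  have hσa : ∀ (g : (Gqs L v)) (d : (latticeGraph (galAdicCompletionMap (L := L) (IsCMField.complexConj L) hw) ϖ ((StdForm.antidiagonal 3).over (w.1.adicCompletion L))).edgeSet), τ.head ((a g).mapEdgeSet d) = a g (τ.head d) ∧ τ.tail ((a g).mapEdgeSet d) = a g (τ.tail d) := fun g d => by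
    rw [ha]; exact head_mapEdgeSet_latticeGraphIso (galAdicCompletionMap (L := L) (IsCMField.complexConj L) hw) ϖ ((StdForm.antidiagonal 3).over (w.1.adicCompletion L)) hτ (eA g) d
  have hfixE : ∀ (g : (Gqs L v)) (d : (latticeGraph (galAdicCompletionMap (L := L) (IsCMField.complexConj L) hw) ϖ ((StdForm.antidiagonal 3).over (w.1.adicCompletion L))).edgeSet), (a g).mapEdgeSet d = d ↔ a g (τ.head d) = τ.head d ∧ a g (τ.tail d) = τ.tail d :=
    mapEdgeSet_eq_iff L v w hw eA ha τ hτ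
  have hadj₁ : (latticeGraph (galAdicCompletionMap (L := L) (IsCMField.complexConj L) hw) ϖ ((StdForm.antidiagonal 3).over (w.1.adicCompletion L))).Adj (τ.head d₁) (τ.tail d₁) := τ.adj_head_tail d₁
  -- «level ≥ 1 fixes the closed star», place-free (★ FILE P §6 through `eA`)
  have hUadj : ∀ {g : (Gqs L v)} {x y : {M : Submodule 𝒪[(w.1.adicCompletion L)] (Fin 3 → (w.1.adicCompletion L)) // IsVertex (galAdicCompletionMap (L := L) (IsCMField.complexConj L) hw) ϖ ((StdForm.antidiagonal 3).over (w.1.adicCompletion L)) M}},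
      g ∈ U x → (latticeGraph (galAdicCompletionMap (L := L) (IsCMField.complexConj L) hw) ϖ ((StdForm.antidiagonal 3).over (w.1.adicCompletion L))).Adj x y → a g y = y := fun {g x y} hg hxy => by
    rw [ha]
    exact latticeGraphIso_apply_eq_of_mem_unitaryLevel_of_adj_of_v (map_unitaryLevel_mem_iff hU) hvσ hϖ (Subgroup.mem_map_of_mem eA.toMonoidHom hg) hxy
  -- `U_{d₁} ≤ P₁ ≤ N(U_{d₁})`, `P₁` compact open
  have hUP : U (τ.head d₁) ⊔ U (τ.tail d₁) ≤ P₁ :=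
    sup_le (fun u hu => (hP₁ u).2 ((hfixE u d₁).2 ⟨actionHom_apply_eq_of_mem ha hU hu, hUadj hu hadj₁⟩))
      (fun u hu => (hP₁ u).2 ((hfixE u d₁).2 ⟨hUadj hu hadj₁.symm, actionHom_apply_eq_of_mem ha hU hu⟩))
  have hPU : P₁ ≤ Subgroup.normalizer ((U (τ.head d₁) ⊔ U (τ.tail d₁) : Subgroup (Gqs L v)) : Set (Gqs L v)) := fun g hg =>
    mem_normalizer_sup_of_mem (mem_normalizer_unitaryLevel_gqs_of_apply_eq ha hU ((hfixE g d₁).1 ((hP₁ g).1 hg)).1)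
      (mem_normalizer_unitaryLevel_gqs_of_apply_eq ha hU ((hfixE g d₁).1 ((hP₁ g).1 hg)).2)
  have hPo : IsOpen (P₁ : Set (Gqs L v)) := Subgroup.isOpen_mono hUP (hEo d₁)
  have hPc : IsCompact (P₁ : Set (Gqs L v)) :=
    (isCompact_setOf_actionHom_apply_eq L v w hw eA ha (τ.head d₁)).of_isClosed_subset (Subgroup.isClosed_of_isOpen P₁ hPo)
      fun g hg => ((hfixE g d₁).1 ((hP₁ g).1 hg)).1
  -- the edge orbit as a `G_v`-set
  have hE1 : ∀ d : (latticeGraph (galAdicCompletionMap (L := L) (IsCMField.complexConj L) hw) ϖ ((StdForm.antidiagonal 3).over (w.1.adicCompletion L))).edgeSet, (fun (g : (Gqs L v)) (d : (latticeGraph (galAdicCompletionMap (L := L) (IsCMField.complexConj L) hw) ϖ ((StdForm.antidiagonal 3).over (w.1.adicCompletion L))).edgeSet) => (a g).mapEdgeSet d) 1 d = d := fun d => by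
    beta_reduce
    rw [map_one, BakerNorine.mapEdgeSet_one]
  have hEmul : ∀ (g h : (Gqs L v)) (d : (latticeGraph (galAdicCompletionMap (L := L) (IsCMField.complexConj L) hw) ϖ ((StdForm.antidiagonal 3).over (w.1.adicCompletion L))).edgeSet),
      (fun (g : (Gqs L v)) (d : (latticeGraph (galAdicCompletionMap (L := L) (IsCMField.complexConj L) hw) ϖ ((StdForm.antidiagonal 3).over (w.1.adicCompletion L))).edgeSet) => (a g).mapEdgeSet d) (g * h) d =
        (fun (g : (Gqs L v)) (d : (latticeGraph (galAdicCompletionMap (L := L) (IsCMField.complexConj L) hw) ϖ ((StdForm.antidiagonal 3).over (w.1.adicCompletion L))).edgeSet) => (a g).mapEdgeSet d) g ((fun (g : (Gqs L v)) (d : (latticeGraph (galAdicCompletionMap (L := L) (IsCMField.complexConj L) hw) ϖ ((StdForm.antidiagonal 3).over (w.1.adicCompletion L))).edgeSet) => (a g).mapEdgeSet d) h d) := fun g h d => by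
    beta_reduce
    rw [map_mul, BakerNorine.mapEdgeSet_mul]
  have hV : ∀ d : (latticeGraph (galAdicCompletionMap (L := L) (IsCMField.complexConj L) hw) ϖ ((StdForm.antidiagonal 3).over (w.1.adicCompletion L))).edgeSet, ∃ g : (Gqs L v), (fun (g : (Gqs L v)) (d : (latticeGraph (galAdicCompletionMap (L := L) (IsCMField.complexConj L) hw) ϖ ((StdForm.antidiagonal 3).over (w.1.adicCompletion L))).edgeSet) => (a g).mapEdgeSet d) g d₁ = d := fun d =>
    htrE d₁ d
  have hUg : ∀ (g : (Gqs L v)) (d : (latticeGraph (galAdicCompletionMap (L := L) (IsCMField.complexConj L) hw) ϖ ((StdForm.antidiagonal 3).over (w.1.adicCompletion L))).edgeSet),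
      U (τ.head ((fun (g : (Gqs L v)) (d : (latticeGraph (galAdicCompletionMap (L := L) (IsCMField.complexConj L) hw) ϖ ((StdForm.antidiagonal 3).over (w.1.adicCompletion L))).edgeSet) => (a g).mapEdgeSet d) g d)) ⊔ U (τ.tail ((fun (g : (Gqs L v)) (d : (latticeGraph (galAdicCompletionMap (L := L) (IsCMField.complexConj L) hw) ϖ ((StdForm.antidiagonal 3).over (w.1.adicCompletion L))).edgeSet) => (a g).mapEdgeSet d) g d)) =
        (U (τ.head d) ⊔ U (τ.tail d)).map (MulAut.conj g).toMonoidHom := fun g d => by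
    beta_reduce
    obtain ⟨h1, h2⟩ := hσa g d
    rw [h1, h2, Subgroup.map_sup, unitaryLevel_gqs_actionHom_eq_map_conj ha hU g (τ.head d), unitaryLevel_gqs_actionHom_eq_map_conj ha hU g (τ.tail d)]
  have h := classOrbitalIntegral_kType_eq_smul_finsum_levelTrace ρ (fun (g : (Gqs L v)) (d : (latticeGraph (galAdicCompletionMap (L := L) (IsCMField.complexConj L) hw) ϖ ((StdForm.antidiagonal 3).over (w.1.adicCompletion L))).edgeSet) => (a g).mapEdgeSet d) hE1 hEmul hQ hcanQ hreg hO hV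
    P₁ hP₁ hPo hPc (fun d => U (τ.head d) ⊔ U (τ.tail d)) hEo hEc hUg hUP hPU τ₁ hτρ₁ (fun u hu => hτ₁ ⟨u, hUP hu⟩ hu) hfP hf0
  beta_reduce at h
  exact h

/-! ## §2 The TAME dischargers (`_of_v_two`: `|2| = 1` and an involution; `_of_neg`: `σ ϖ = −ϖ`, `|2| = 1`) -/

/-- **ONE ORBIT OF SELF-DUAL VERTICES at every place with `|2| = 1`** (`htr₀` by ★ `exists_unitary_mapGL_stdLattice_eq_of_isSelfDualLattice_of_v_two`; in particular at a TAME
RAMIFIED place). [cite: Jacobowitz1962, §4–§8] [cite: BruhatTits1972, §10] -/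
theorem exists_actionHom_apply_eq_of_isVertexLattice_zero_of_v_two
    (hσ : ∀ x, (galAdicCompletionMap (L := L) (IsCMField.complexConj L) hw) ((galAdicCompletionMap (L := L) (IsCMField.complexConj L) hw) x) = x) (hvσ : ∀ x, Valued.v ((galAdicCompletionMap (L := L) (IsCMField.complexConj L) hw) x) = Valued.v x) (hϖ : Valued.v ϖ = WithZero.exp (-1 : ℤ)) (h2 : Valued.v (2 : (w.1.adicCompletion L)) = 1)
    (eA : (Gqs L v) ≃ₜ* ↥(unitaryGroupOfForm (galAdicCompletionMap (L := L) (IsCMField.complexConj L) hw) ((StdForm.antidiagonal 3).over (w.1.adicCompletion L))))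
    {a : (Gqs L v) →* ((latticeGraph (galAdicCompletionMap (L := L) (IsCMField.complexConj L) hw) ϖ ((StdForm.antidiagonal 3).over (w.1.adicCompletion L))) ≃g (latticeGraph (galAdicCompletionMap (L := L) (IsCMField.complexConj L) hw) ϖ ((StdForm.antidiagonal 3).over (w.1.adicCompletion L))))} (ha : ∀ g, a g = latticeGraphIso (galAdicCompletionMap (L := L) (IsCMField.complexConj L) hw) ϖ ((StdForm.antidiagonal 3).over (w.1.adicCompletion L)) (eA g))
    (x y : {M : Submodule 𝒪[(w.1.adicCompletion L)] (Fin 3 → (w.1.adicCompletion L)) // IsVertex (galAdicCompletionMap (L := L) (IsCMField.complexConj L) hw) ϖ ((StdForm.antidiagonal 3).over (w.1.adicCompletion L)) M}) (hx : IsVertexLattice (galAdicCompletionMap (L := L) (IsCMField.complexConj L) hw) ϖ ((StdForm.antidiagonal 3).over (w.1.adicCompletion L)) 0 x.1) (hy : IsVertexLattice (galAdicCompletionMap (L := L) (IsCMField.complexConj L) hw) ϖ ((StdForm.antidiagonal 3).over (w.1.adicCompletion L)) 0 y.1) : ∃ g : (Gqs L v), a g x = y :=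
  exists_actionHom_apply_eq_of_isVertexLattice_zero_of_involution L v w hw eA ha
    (fun _ hM => exists_unitary_mapGL_stdLattice_eq_of_isSelfDualLattice_of_v_two hσ hvσ hϖ h2 hM) x y hx hy

/-- **ONE ORBIT OF TYPE-TWO VERTICES at a tame ramified place** (`htr₂` by ★ `forall_isVertexLattice_two_exists_mapGL_N₁_eq_of_neg`). [cite: Jacobowitz1962, §8] [cite: BruhatTits1972, §10] -/
theorem exists_actionHom_apply_eq_of_isVertexLattice_two_of_neg
    (hσ : ∀ x, (galAdicCompletionMap (L := L) (IsCMField.complexConj L) hw) ((galAdicCompletionMap (L := L) (IsCMField.complexConj L) hw) x) = x) (hvσ : ∀ x, Valued.v ((galAdicCompletionMap (L := L) (IsCMField.complexConj L) hw) x) = Valued.v x) (hϖ : Valued.v ϖ = WithZero.exp (-1 : ℤ))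
    (hσϖ : (galAdicCompletionMap (L := L) (IsCMField.complexConj L) hw) ϖ = -ϖ) (hres : ∀ x : (w.1.adicCompletion L), Valued.v x ≤ 1 → Valued.v ((galAdicCompletionMap (L := L) (IsCMField.complexConj L) hw) x - x) < 1) (h2 : Valued.v (2 : (w.1.adicCompletion L)) = 1) (hnorm : ∀ u : (w.1.adicCompletion L), (galAdicCompletionMap (L := L) (IsCMField.complexConj L) hw) u = u → Valued.v (u - 1) < 1 → ∃ z : (w.1.adicCompletion L), z * (galAdicCompletionMap (L := L) (IsCMField.complexConj L) hw) z = u ∧ Valued.v (z - 1) ≤ Valued.v (u - 1))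
    (eA : (Gqs L v) ≃ₜ* ↥(unitaryGroupOfForm (galAdicCompletionMap (L := L) (IsCMField.complexConj L) hw) ((StdForm.antidiagonal 3).over (w.1.adicCompletion L))))
    {a : (Gqs L v) →* ((latticeGraph (galAdicCompletionMap (L := L) (IsCMField.complexConj L) hw) ϖ ((StdForm.antidiagonal 3).over (w.1.adicCompletion L))) ≃g (latticeGraph (galAdicCompletionMap (L := L) (IsCMField.complexConj L) hw) ϖ ((StdForm.antidiagonal 3).over (w.1.adicCompletion L))))} (ha : ∀ g, a g = latticeGraphIso (galAdicCompletionMap (L := L) (IsCMField.complexConj L) hw) ϖ ((StdForm.antidiagonal 3).over (w.1.adicCompletion L)) (eA g))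
    (x y : {M : Submodule 𝒪[(w.1.adicCompletion L)] (Fin 3 → (w.1.adicCompletion L)) // IsVertex (galAdicCompletionMap (L := L) (IsCMField.complexConj L) hw) ϖ ((StdForm.antidiagonal 3).over (w.1.adicCompletion L)) M}) (hx : IsVertexLattice (galAdicCompletionMap (L := L) (IsCMField.complexConj L) hw) ϖ ((StdForm.antidiagonal 3).over (w.1.adicCompletion L)) 2 x.1) (hy : IsVertexLattice (galAdicCompletionMap (L := L) (IsCMField.complexConj L) hw) ϖ ((StdForm.antidiagonal 3).over (w.1.adicCompletion L)) 2 y.1) : ∃ g : (Gqs L v), a g x = y :=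
  exists_actionHom_apply_eq_of_isVertexLattice_two_of_involution L v w hw eA ha
    (forall_isVertexLattice_two_exists_mapGL_N₁_eq_of_neg hσ hvσ hϖ hσϖ hres h2 hnorm) x y hx hy

/-- **ONE ORBIT OF EDGES at every place with `|2| = 1`** (`hflag` by ★ E4-RAM `forall_flag_exists_unitary_of_v_two`; no condition on `σ ϖ`). [cite: BruhatTits1972, §10]
[cite: SchneiderStuhler1997, §III.4] -/
theorem exists_mapEdgeSet_eq_of_v_two
    (hσ : ∀ x, (galAdicCompletionMap (L := L) (IsCMField.complexConj L) hw) ((galAdicCompletionMap (L := L) (IsCMField.complexConj L) hw) x) = x) (hvσ : ∀ x, Valued.v ((galAdicCompletionMap (L := L) (IsCMField.complexConj L) hw) x) = Valued.v x) (hϖ : Valued.v ϖ = WithZero.exp (-1 : ℤ)) (h2 : Valued.v (2 : (w.1.adicCompletion L)) = 1)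
    (eA : (Gqs L v) ≃ₜ* ↥(unitaryGroupOfForm (galAdicCompletionMap (L := L) (IsCMField.complexConj L) hw) ((StdForm.antidiagonal 3).over (w.1.adicCompletion L))))
    {a : (Gqs L v) →* ((latticeGraph (galAdicCompletionMap (L := L) (IsCMField.complexConj L) hw) ϖ ((StdForm.antidiagonal 3).over (w.1.adicCompletion L))) ≃g (latticeGraph (galAdicCompletionMap (L := L) (IsCMField.complexConj L) hw) ϖ ((StdForm.antidiagonal 3).over (w.1.adicCompletion L))))} (ha : ∀ g, a g = latticeGraphIso (galAdicCompletionMap (L := L) (IsCMField.complexConj L) hw) ϖ ((StdForm.antidiagonal 3).over (w.1.adicCompletion L)) (eA g))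
    (τ : Orientation (latticeGraph (galAdicCompletionMap (L := L) (IsCMField.complexConj L) hw) ϖ ((StdForm.antidiagonal 3).over (w.1.adicCompletion L)))) (hτ : ∀ d, τ.tail d < τ.head d)
    (d d' : (latticeGraph (galAdicCompletionMap (L := L) (IsCMField.complexConj L) hw) ϖ ((StdForm.antidiagonal 3).over (w.1.adicCompletion L))).edgeSet) : ∃ g : (Gqs L v), (a g).mapEdgeSet d = d' :=
  exists_mapEdgeSet_eq_of_involution L v w hw hvσ hϖ (fun g₁ hg₁ => forall_flag_exists_unitary_of_v_two hσ hvσ hϖ h2 g₁ hg₁) eA ha τ hτ d d'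

set_option maxHeartbeats 400000 in
/-- **THE ORBITAL INTEGRAL OF A `K`-TYPE FUNCTION ON THE EDGE ORBIT at every place with `|2| = 1`** (in particular at a TAME RAMIFIED place): ★ 48's
`classOrbitalIntegral_kType_edge_eq` with `hd` replaced by `hσ hvσ hϖ h2`, conclusion VERBATIM (`htrE` by `exists_mapEdgeSet_eq_of_v_two`). [cite: SchneiderStuhler1997, §III.4]
[cite: Kottwitz1988, §2] [cite: Rogawski1990, §4.9 p. 54] -/
theorem classOrbitalIntegral_kType_edge_eq_of_v_two
    (hσ : ∀ x, (galAdicCompletionMap (L := L) (IsCMField.complexConj L) hw) ((galAdicCompletionMap (L := L) (IsCMField.complexConj L) hw) x) = x) (hvσ : ∀ x, Valued.v ((galAdicCompletionMap (L := L) (IsCMField.complexConj L) hw) x) = Valued.v x) (hϖ : Valued.v ϖ = WithZero.exp (-1 : ℤ)) (h2 : Valued.v (2 : (w.1.adicCompletion L)) = 1)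
    (eA : (Gqs L v) ≃ₜ* ↥(unitaryGroupOfForm (galAdicCompletionMap (L := L) (IsCMField.complexConj L) hw) ((StdForm.antidiagonal 3).over (w.1.adicCompletion L))))
    {a : (Gqs L v) →* ((latticeGraph (galAdicCompletionMap (L := L) (IsCMField.complexConj L) hw) ϖ ((StdForm.antidiagonal 3).over (w.1.adicCompletion L))) ≃g (latticeGraph (galAdicCompletionMap (L := L) (IsCMField.complexConj L) hw) ϖ ((StdForm.antidiagonal 3).over (w.1.adicCompletion L))))} (ha : ∀ g, a g = latticeGraphIso (galAdicCompletionMap (L := L) (IsCMField.complexConj L) hw) ϖ ((StdForm.antidiagonal 3).over (w.1.adicCompletion L)) (eA g))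
    [MeasurableSpace (Gqs L v)] [BorelSpace (Gqs L v)]
    [∀ γ : (Gqs L v), MeasurableSpace ((Gqs L v) ⧸ Subgroup.centralizer ({γ} : Set (Gqs L v)))]
    [∀ γ : (Gqs L v), BorelSpace ((Gqs L v) ⧸ Subgroup.centralizer ({γ} : Set (Gqs L v)))]
    (νQv : Measure (Gqs L v)) [νQv.IsHaarMeasure] [νQv.IsMulRightInvariant]
    {mQv : OrbitalMeasureFamily (Gqs L v)} (hcanQ : mQv.IsCanonical (fun γ => IsRegularElt (γ.val : GL (Fin 3) (UnitaryGroup.LocalRing L v))) νQv)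
    (τ : Orientation (latticeGraph (galAdicCompletionMap (L := L) (IsCMField.complexConj L) hw) ϖ ((StdForm.antidiagonal 3).over (w.1.adicCompletion L)))) (hτ : ∀ d, τ.tail d < τ.head d)
    {e : ℕ} {U : {M : Submodule 𝒪[(w.1.adicCompletion L)] (Fin 3 → (w.1.adicCompletion L)) // IsVertex (galAdicCompletionMap (L := L) (IsCMField.complexConj L) hw) ϖ ((StdForm.antidiagonal 3).over (w.1.adicCompletion L)) M} → Subgroup (Gqs L v)}
    (hU : ∀ x g, g ∈ U x ↔ mapGL ((eA g : ↥(unitaryGroupOfForm (galAdicCompletionMap (L := L) (IsCMField.complexConj L) hw) ((StdForm.antidiagonal 3).over (w.1.adicCompletion L)))) : GL (Fin 3) (w.1.adicCompletion L)) x.1 = x.1 ∧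
      x.1.map ((Matrix.toLin' ((((eA g : ↥(unitaryGroupOfForm (galAdicCompletionMap (L := L) (IsCMField.complexConj L) hw) ((StdForm.antidiagonal 3).over (w.1.adicCompletion L)))) : GL (Fin 3) (w.1.adicCompletion L)) : Matrix (Fin 3) (Fin 3) (w.1.adicCompletion L)) - 1)).restrictScalars 𝒪[(w.1.adicCompletion L)]) ≤ scaleLattice (ϖ ^ (e + 1)) x.1)
    (hEo : ∀ d : (latticeGraph (galAdicCompletionMap (L := L) (IsCMField.complexConj L) hw) ϖ ((StdForm.antidiagonal 3).over (w.1.adicCompletion L))).edgeSet, IsOpen ((U (τ.head d) ⊔ U (τ.tail d) : Subgroup (Gqs L v)) : Set (Gqs L v)))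
    (hEc : ∀ d : (latticeGraph (galAdicCompletionMap (L := L) (IsCMField.complexConj L) hw) ϖ ((StdForm.antidiagonal 3).over (w.1.adicCompletion L))).edgeSet, IsCompact ((U (τ.head d) ⊔ U (τ.tail d) : Subgroup (Gqs L v)) : Set (Gqs L v)))
    (d₁ : (latticeGraph (galAdicCompletionMap (L := L) (IsCMField.complexConj L) hw) ϖ ((StdForm.antidiagonal 3).over (w.1.adicCompletion L))).edgeSet) (P₁ : Subgroup (Gqs L v)) (hP₁ : ∀ g, g ∈ P₁ ↔ (a g).mapEdgeSet d₁ = d₁)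
    {V : Type*} [AddCommGroup V] [Module ℂ V] (ρ : Representation ℂ (Gqs L v) V) [FiniteDimensional ℂ ↥(ρ.fixedPoints (U (τ.head d₁) ⊔ U (τ.tail d₁)))]
    (τ₁ : Representation ℂ ↥P₁ ↥(ρ.fixedPoints (U (τ.head d₁) ⊔ U (τ.tail d₁))))
    (hτρ₁ : ∀ (p : ↥P₁) (x : ↥(ρ.fixedPoints (U (τ.head d₁) ⊔ U (τ.tail d₁)))), ((τ₁ p x : ↥(ρ.fixedPoints (U (τ.head d₁) ⊔ U (τ.tail d₁)))) : V) = ρ (p : (Gqs L v)) (x : V))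
    (hτ₁ : ∀ p : ↥P₁, (p : (Gqs L v)) ∈ U (τ.head d₁) ⊔ U (τ.tail d₁) → τ₁ p = 1)
    {f : (Gqs L v) → ℂ} (hfP : ∀ (g : (Gqs L v)) (hg : g ∈ P₁), f g = Representation.character τ₁ ⟨g, hg⟩⁻¹) (hf0 : ∀ g ∉ P₁, f g = 0)
    {γ : (Gqs L v)} (hreg : IsRegularElt (γ.val : GL (Fin 3) (UnitaryGroup.LocalRing L v)))
    (hell : IsCompact ((Subgroup.centralizer ({γ} : Set (Gqs L v))) : Set (Gqs L v))) :
    classOrbitalIntegral mQv f (ConjClasses.mk γ) =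
      νQv.real (P₁ : Set (Gqs L v)) • ∑ᶠ d ∈ {d : (latticeGraph (galAdicCompletionMap (L := L) (IsCMField.complexConj L) hw) ϖ ((StdForm.antidiagonal 3).over (w.1.adicCompletion L))).edgeSet | (a γ).mapEdgeSet d = d}, ρ.levelTrace (hEo d) (hEc d) γ⁻¹ :=
  classOrbitalIntegral_kType_edge_eq_of_involution L v w hw hvσ hϖ eA ha νQv hcanQ τ hτ (exists_mapEdgeSet_eq_of_v_two L v w hw hσ hvσ hϖ h2 eA ha τ hτ)
    hU hEo hEc d₁ P₁ hP₁ ρ τ₁ hτρ₁ hτ₁ hfP hf0 hreg hell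

end Datum

end Summit.HodgeConjecture.HodgeConjecture.Cruxes.H413.F0P3cStCharTSEPFunctionOrbitalOrbitsRamified

end
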